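import Summits.Ventures.Crystal3D.Bulk.RotSysEuler
import Mathlib.Analysis.SpecialFunctions.Trigonometric.Basic
import HarnessLib

/-!
# Weighted corners of a sub-rotation-system: the corner at a dart, the corner sum and the
# angular excess of a face, and their behaviour when one edge is deleted (generic brick for
# the connectedness theorem P-L3(b) L1, `phase2/LEAN-FACES-DESIGN.md` §5.6 (i))

HONEST FRAMING. Part of the venture `Summits/Ventures/Crystal3D` (cell `pub-crystal3d`, phase 2;
seat p3), PURELY COMBINATORIAL and generic (folklore): no geometry. A rotation system `(σ, α)`
on a finite dart type `D` carries a WEIGHT `w : D → ℝ` — the angle of the `σ`-sector that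
starts at a dart (for the hull fan triangulation: the angle of the fan triangle at that dart).
For an `α`-closed dart set `S` (a sub-map with the induced rotation `induce σ S` of
`Bulk/RotSysInduce.lean`) this file defines

* `retTime` bookkeeping: `retTime_eq_of_first_return`, `retTime_subset_of_mem`,
  `retTime_subset_of_not_mem` (the first return to a smaller set is one or two returns to the
  bigger one);
* `cornerAt σ w S z = Σ_{m < retTime σ S z} w (σ^m z)` — the corner of the sub-map at the dart
  `z ∈ S` (the total weight of the ambient sectors between `z` and its `S`-successor);
  `cornerAt_subset_of_mem/_of_not_mem`, `cornerAt_eq_cornerAt_singleton_of_alone` (a dart alone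
  at its vertex sees the full vertex), and THE POINTWISE SPLICE **`IsRotSys.cornerAt_sdiff`**:
  deleting the edge `{d, α d}` from `S′ ∋ d` adds the corner of `d` (resp. `α d`) to the corner
  of its `S′`-predecessor and changes nothing else;
* `face σ α S x` (the `φ_S`-orbit of `x` inside `S`, `φ_S = induce σ S ∘ α`), `faceSum`
  (`Σ_{y ∈ face} cornerAt S (α y)`: the corners met along the face) and the **angular excess**
  `excess σ α w S x = faceSum − (#face − 2)·π`;
* `excess_lt_two_pi_of_cornerAt_lt` — if every corner of `S` is `< π`, every face of `S` has
  excess `< 2π`.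

The face-level behaviour under edge deletion (faces away from the edge; the corner sum near the
edge; MERGE/SPLIT) is in `Bulk/RotSysFaceSdiff.lean` and `Bulk/RotSysFaceGlue.lean`; nothing here
mentions GAP(1.26).
-/

namespace Summit.Ventures.Crystal3D

namespace RotSys

open Equiv Equiv.Perm Finset

variable {D : Type*} [DecidableEq D] [Fintype D]

/-! ## First-return times under change of the dart set -/

/-- **Characterisation of the first-return time by a witness.** -/
theorem retTime_eq_of_first_return (σ : Perm D) {S : Finset D} {x : D} (hx : x ∈ S) {n : ℕ}
    (hn0 : 0 < n) (hmem : (σ ^ n) x ∈ S) (hmin : ∀ m, 0 < m → m < n → (σ ^ m) x ∉ S) :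
    retTime σ S x = n := by
  refine le_antisymm (retTime_le_of_mem σ hx hn0 hmem) ?_
  by_contra hlt
  exact hmin _ (retTime_spec σ hx).1 (not_le.1 hlt) (retTime_spec σ hx).2

/-- For `S ⊆ S′` and `x ∈ S` whose `S′`-successor lies in `S`: the first return to `S` IS the
first return to `S′`. -/
theorem retTime_subset_of_mem (σ : Perm D) {S S' : Finset D} (hsub : S ⊆ S') {x : D}
    (hx : x ∈ S) (hmem : induce σ S' x ∈ S) : retTime σ S x = retTime σ S' x := by
  have hxS' : x ∈ S' := hsub hx
  obtain ⟨hr0, -⟩ := retTime_spec σ hxS'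
  refine retTime_eq_of_first_return σ hx hr0 ?_ ?_
  · rw [← induce_apply_of_mem σ hxS']; exact hmem
  · intro m hm0 hm hmem'
    exact pow_not_mem_of_lt_retTime σ hxS' hm0 hm (hsub hmem')

/-- For `S ⊆ S′` and `x ∈ S` whose `S′`-successor `y` is NOT in `S` but whose second
`S′`-return is: the first return to `S` takes `retTime S′ x + retTime S′ y` steps. -/
theorem retTime_subset_of_not_mem (σ : Perm D) {S S' : Finset D} (hsub : S ⊆ S') {x : D}
    (hx : x ∈ S) (hnot : induce σ S' x ∉ S) (hmem : induce σ S' (induce σ S' x) ∈ S) :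
    retTime σ S x = retTime σ S' x + retTime σ S' (induce σ S' x) := by
  have hxS' : x ∈ S' := hsub hx
  set y := induce σ S' x with hy
  have hyS' : y ∈ S' := induce_apply_mem σ hxS'
  obtain ⟨hr0, -⟩ := retTime_spec σ hxS'
  obtain ⟨hs0, -⟩ := retTime_spec σ hyS'
  set r := retTime σ S' x with hr
  set s := retTime σ S' y with hs
  have hval : (σ ^ (r + s)) x = induce σ S' y := by
    rw [add_comm, pow_add, Perm.mul_apply, ← induce_apply_of_mem σ hxS', ← hy,
      ← induce_apply_of_mem σ hyS']
  refine retTime_eq_of_first_return σ hx (by omega) (by rw [hval]; exact hmem) ?_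
  intro m hm0 hm hmem'
  rcases lt_trichotomy m r with hlt | heq | hgt
  · exact pow_not_mem_of_lt_retTime σ hxS' hm0 hlt (hsub hmem')
  · rw [heq, ← induce_apply_of_mem σ hxS'] at hmem'
    exact hnot hmem'
  · have e : (σ ^ m) x = (σ ^ (m - r)) y := by
      rw [hy, induce_apply_of_mem σ hxS', ← hr, ← Perm.mul_apply, ← pow_add,
        Nat.sub_add_cancel hgt.le]
    rw [e] at hmem'
    exact pow_not_mem_of_lt_retTime σ hyS' (Nat.sub_pos_of_lt hgt) (by omega) (hsub hmem')

/-! ## The corner at a dart -/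

/-- **The corner of the sub-map `S` at the dart `z`**: the total weight of the ambient sectors
swept from `z` (inclusive) to its `S`-successor `induce σ S z` (exclusive):
`Σ_{m < retTime σ S z} w (σ^m z)`. -/
noncomputable def cornerAt (σ : Perm D) (w : D → ℝ) (S : Finset D) (z : D) : ℝ :=
  ∑ m ∈ range (retTime σ S z), w ((σ ^ m) z)

/-- On the full dart set every corner is a single sector: `cornerAt σ w univ z = w z`. -/
theorem cornerAt_univ (σ : Perm D) (w : D → ℝ) (z : D) : cornerAt σ w univ z = w z := by
  unfold cornerAt
  rw [retTime_eq_of_first_return σ (mem_univ z) Nat.one_pos (mem_univ _)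
    (fun m hm0 hm1 => absurd hm1 (by omega))]
  simp

/-- Same `S′`-successor in `S`: same corner. -/
theorem cornerAt_subset_of_mem (σ : Perm D) (w : D → ℝ) {S S' : Finset D} (hsub : S ⊆ S')
    {x : D} (hx : x ∈ S) (hmem : induce σ S' x ∈ S) : cornerAt σ w S x = cornerAt σ w S' x := by
  unfold cornerAt
  rw [retTime_subset_of_mem σ hsub hx hmem]

/-- One skipped `S′`-dart `y`: the `S`-corner at `x` is the `S′`-corner at `x` plus the
`S′`-corner at `y`. -/
theorem cornerAt_subset_of_not_mem (σ : Perm D) (w : D → ℝ) {S S' : Finset D} (hsub : S ⊆ S')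
    {x : D} (hx : x ∈ S) (hnot : induce σ S' x ∉ S) (hmem : induce σ S' (induce σ S' x) ∈ S) :
    cornerAt σ w S x = cornerAt σ w S' x + cornerAt σ w S' (induce σ S' x) := by
  unfold cornerAt
  rw [retTime_subset_of_not_mem σ hsub hx hnot hmem, Finset.sum_range_add]
  congr 1
  refine Finset.sum_congr rfl fun m _ => ?_
  rw [induce_apply_of_mem σ (hsub hx), ← Perm.mul_apply, ← pow_add, add_comm]

/-- A dart ALONE at its vertex in `S` (fixed by the induced rotation) has the same first-return
time as in `{z}`: the full turn. -/
theorem retTime_eq_retTime_singleton_of_alone (σ : Perm D) {S : Finset D} {z : D} (hz : z ∈ S)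
    (halone : induce σ S z = z) : retTime σ S z = retTime σ {z} z := by
  symm
  obtain ⟨hr0, -⟩ := retTime_spec σ hz
  refine retTime_eq_of_first_return σ (mem_singleton_self z) hr0 ?_ ?_
  · rw [← induce_apply_of_mem σ hz, halone]; exact mem_singleton_self z
  · intro m hm0 hm hmem
    rw [mem_singleton] at hmem
    exact pow_not_mem_of_lt_retTime σ hz hm0 hm (by rw [hmem]; exact hz)

/-- **A dart alone at its vertex sees the full vertex**: its corner is the total weight of its
`σ`-cycle, `cornerAt σ w {z} z`. -/
theorem cornerAt_eq_cornerAt_singleton_of_alone (σ : Perm D) (w : D → ℝ) {S : Finset D} {z : D}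
    (hz : z ∈ S) (halone : induce σ S z = z) : cornerAt σ w S z = cornerAt σ w {z} z := by
  unfold cornerAt
  rw [retTime_eq_retTime_singleton_of_alone σ hz halone]

/-! ## Deleting one edge: the pointwise splice of the corners -/

section Sdiff

variable {σ α : Perm D} {S : Finset D} {d : D}

omit [Fintype D] in
/-- Membership in `S ∖ {d, α d}` unfolded. -/
theorem mem_sdiff_pair_iff {z : D} : z ∈ S \ {d, α d} ↔ z ∈ S ∧ z ≠ d ∧ z ≠ α d := by
  rw [Finset.mem_sdiff, Finset.mem_insert, Finset.mem_singleton, not_or]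

/-- If the `S`-successor of a surviving dart `z` is `d`, then the `S`-successor of `d` survives
the deletion of `{d, α d}`. -/
theorem IsRotSys.induce_mem_sdiff_of_induce_eq (h : IsRotSys σ α) (hd : d ∈ S) {z : D}
    (hz : z ∈ S \ {d, α d}) (he : induce σ S z = d) : induce σ S d ∈ S \ {d, α d} := by
  obtain ⟨hzS, hzd, -⟩ := mem_sdiff_pair_iff.1 hz
  refine mem_sdiff_pair_iff.2 ⟨induce_apply_mem σ hd, ?_, h.induce_ne_alpha S d⟩
  refine induce_ne_self_of_mem_cycle σ hd hzS hzd ?_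
  have := sameCycle_induce_apply σ S z
  rw [he] at this
  exact this.symm

/-- The same at the other end `α d`. -/
theorem IsRotSys.induce_mem_sdiff_of_induce_eq_alpha (h : IsRotSys σ α) (hS : IsClosed α S)
    (hd : d ∈ S) {z : D} (hz : z ∈ S \ {d, α d}) (he : induce σ S z = α d) :
    induce σ S (α d) ∈ S \ {d, α d} := by
  obtain ⟨hzS, -, hzα⟩ := mem_sdiff_pair_iff.1 hz
  have hαd : α d ∈ S := hS d hd
  refine mem_sdiff_pair_iff.2 ⟨induce_apply_mem σ hαd, ?_, ?_⟩
  · have := h.induce_ne_alpha S (α d)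
    rwa [h.α_inv] at this
  · refine induce_ne_self_of_mem_cycle σ hαd hzS hzα ?_
    have := sameCycle_induce_apply σ S z
    rw [he] at this
    exact this.symm

/-- **(P) The pointwise splice of the corners.** For a loopless rotation system, an `α`-closed
`S ∋ d` and a surviving dart `z ∈ S ∖ {d, α d}`: the corner of `S ∖ {d, α d}` at `z` is the
corner of `S` at `z`, plus the corner of `S` at `d` if `d` was the `S`-successor of `z`, plus the
corner of `S` at `α d` if `α d` was. -/
theorem IsRotSys.cornerAt_sdiff (h : IsRotSys σ α) (hS : IsClosed α S) (hd : d ∈ S)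
    (w : D → ℝ) {z : D} (hz : z ∈ S \ {d, α d}) :
    cornerAt σ w (S \ {d, α d}) z = cornerAt σ w S z +
      (if induce σ S z = d then cornerAt σ w S d else 0) +
      (if induce σ S z = α d then cornerAt σ w S (α d) else 0) := by
  have hsub : S \ {d, α d} ⊆ S := Finset.sdiff_subset
  have hne : α d ≠ d := h.α_ne d
  by_cases h1 : induce σ S z = d
  · have h2 : induce σ S z ≠ α d := by rw [h1]; exact hne.symm
    rw [if_pos h1, if_neg h2, add_zero]
    have hnot : induce σ S z ∉ S \ {d, α d} := by
      rw [h1, mem_sdiff_pair_iff]; tauto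
    have hmem : induce σ S (induce σ S z) ∈ S \ {d, α d} := by
      rw [h1]; exact h.induce_mem_sdiff_of_induce_eq hd hz h1
    rw [cornerAt_subset_of_not_mem σ w hsub hz hnot hmem, h1]
  · rw [if_neg h1, add_zero]
    by_cases h2 : induce σ S z = α d
    · rw [if_pos h2]
      have hnot : induce σ S z ∉ S \ {d, α d} := by
        rw [h2, mem_sdiff_pair_iff]; tauto
      have hmem : induce σ S (induce σ S z) ∈ S \ {d, α d} := by
        rw [h2]; exact h.induce_mem_sdiff_of_induce_eq_alpha hS hd hz h2
      rw [cornerAt_subset_of_not_mem σ w hsub hz hnot hmem, h2]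
    · rw [if_neg h2, add_zero]
      have hmem : induce σ S z ∈ S \ {d, α d} :=
        mem_sdiff_pair_iff.2 ⟨induce_apply_mem σ (hsub hz), h1, h2⟩
      exact cornerAt_subset_of_mem σ w hsub hz hmem

end Sdiff

/-! ## Faces as finsets, the corner sum and the angular excess of a face -/

section Faces

open scoped Classical

/-- **The face of `x` in the sub-map `S`**: the darts of `S` on the `φ_S`-cycle of `x`
(`φ_S = phi σ α S`). -/
noncomputable def face (σ α : Perm D) (S : Finset D) (x : D) : Finset D :=
  S.filter fun y => (phi σ α S).SameCycle x y

/-- Membership in a face. -/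
theorem mem_face {σ α : Perm D} {S : Finset D} {x y : D} :
    y ∈ face σ α S x ↔ y ∈ S ∧ (phi σ α S).SameCycle x y := by
  unfold face; rw [mem_filter]

/-- A face lies in `S`. -/
theorem face_subset (σ α : Perm D) (S : Finset D) (x : D) : face σ α S x ⊆ S :=
  filter_subset _ _

/-- A dart of `S` lies on its own face. -/
theorem mem_face_self {σ α : Perm D} {S : Finset D} {x : D} (hx : x ∈ S) : x ∈ face σ α S x :=
  mem_face.2 ⟨hx, SameCycle.refl _ x⟩

/-- Darts on a common cycle have the same face. -/
theorem face_eq_of_sameCycle {σ α : Perm D} {S : Finset D} {x y : D}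
    (h : (phi σ α S).SameCycle x y) : face σ α S x = face σ α S y := by
  ext z
  rw [mem_face, mem_face]
  exact ⟨fun ⟨hz, hc⟩ => ⟨hz, h.symm.trans hc⟩, fun ⟨hz, hc⟩ => ⟨hz, h.trans hc⟩⟩

/-- A dart on the face of `x` has the same face. -/
theorem face_eq_of_mem_face {σ α : Perm D} {S : Finset D} {x y : D} (h : y ∈ face σ α S x) :
    face σ α S y = face σ α S x :=
  (face_eq_of_sameCycle (mem_face.1 h).2).symm

/-- **The corner sum of a face**: the corners of `S` met along the face of `x` — from the dart
`y` one crosses to `α y` and turns to the next dart of `S`, sweeping `cornerAt S (α y)`. -/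
noncomputable def faceSum (σ α : Perm D) (w : D → ℝ) (S : Finset D) (x : D) : ℝ :=
  ∑ y ∈ face σ α S x, cornerAt σ w S (α y)

/-- **The angular excess of a face**: corner sum minus `(#face − 2)·π` (for an honest disc face
bounded by geodesic arcs on the unit sphere this is its area, by Gauss–Bonnet). -/
noncomputable def excess (σ α : Perm D) (w : D → ℝ) (S : Finset D) (x : D) : ℝ :=
  faceSum σ α w S x - (((face σ α S x).card : ℝ) - 2) * Real.pi

/-- The corner sum depends only on the face. -/
theorem faceSum_eq_of_mem_face {σ α : Perm D} (w : D → ℝ) {S : Finset D} {x y : D}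
    (h : y ∈ face σ α S x) : faceSum σ α w S y = faceSum σ α w S x := by
  unfold faceSum; rw [face_eq_of_mem_face h]

/-- The excess depends only on the face. -/
theorem excess_eq_of_mem_face {σ α : Perm D} (w : D → ℝ) {S : Finset D} {x y : D}
    (h : y ∈ face σ α S x) : excess σ α w S y = excess σ α w S x := by
  unfold excess; rw [faceSum_eq_of_mem_face w h, face_eq_of_mem_face h]

/-- **If every corner of `S` is `< π`, every face of `S` has excess `< 2π`.** -/
theorem excess_lt_two_pi_of_cornerAt_lt {σ α : Perm D} (w : D → ℝ) {S : Finset D}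
    (hS : IsClosed α S) (hlt : ∀ z ∈ S, cornerAt σ w S z < Real.pi) {x : D} (hx : x ∈ S) :
    excess σ α w S x < 2 * Real.pi := by
  unfold excess faceSum
  have hne : (face σ α S x).Nonempty := ⟨x, mem_face_self hx⟩
  have hlt' : ∑ y ∈ face σ α S x, cornerAt σ w S (α y) <
      ∑ y ∈ face σ α S x, (fun _ => Real.pi) y :=
    Finset.sum_lt_sum_of_nonempty hne fun y hy => hlt _ (hS _ (face_subset σ α S x hy))
  rw [Finset.sum_const, nsmul_eq_mul] at hlt'
  linarith

end Faces


end RotSys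

end Summit.Ventures.Crystal3D
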